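import Summits.QuantumFields.BalabanUV.T4Continuum.Support.NE7BalabanGaugeTransport
import HarnessLib

/-!
# NE7BalabanGaugeTransportRows — THE GAUGE-TRANSPORT LETTER (KL-T) FOR BAŁABAN's BLOCK-LANDAU GAUGE FROM TWO ROWS OF BAŁABAN's SCALAR OPERATORS, NO SMOOTHNESS
# LETTER: (R-H) the HARMONIC EXTENSION of prescribed nested block means (`bmeanIterW h = θ′`, `D_W h ⊥ D_W N(Q′(W))`, `‖h‖_∞ ≤ C_H‖θ′‖_∞` — the sup row of Bałaban's
# scalar minimal extension) and (R-C) the BLOCK-LANDAU CORRECTION (`c ∈ N(Q′(W))`, `Z + D_W c ⊥ D_W N(Q′(W))`, `‖c‖_∞ ≤ C_b‖covDiv_W Z‖_∞` — the sup row of the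
# block-mean-zero constrained scalar propagator; existence = F172); then `λ = σ + h + c`, `C_R = 6dC_H·M`, `C_Ξ = 1 + C_H`, `C_D = C_b` (file 104 of the curved (APE), F174)

Cell `pub-balaban`, rung (B)+1 sub-cell t4, lineage `b2b-balaban-t4-ne7-p1` (CRUX PROVER NE7 #1 = OWNER of row NE7), generation 83; memo
`t4/b2b-balaban-t4-ne7-p1-g83/BALABAN-GAUGE-ROAD.md` §5, §8.  Over F170 `NE7BalabanGaugeTransport` (`QbarIter_gaugeDir_eq_bmean`, `QbarIter_eq_neg_frame_of_tangent`), row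
NE3's `NE3LinearisedAverageSup.norm_framePotW_le_sup` (`C_Φ = 6d`), `norm_bmeanIterW_le_of_sup`, `framePotW_skew_periodic`, `bmeanIterW_skew_periodic`, and the Spine's
`PairLandauB8.avgKernelGauges` BY NAME.
WHY.  F170 split (KL-T) into (T1) a SMOOTH exact right inverse of `bmeanIterW` + (T2) the block-Landau correction priced by the FULL divergence — the smoothness was needed
only because (T2) charges `C_b ≍ M²` per unit of divergence, and a rough extension's Laplacian is `O(1)`.  But the block-Landau representative with prescribed block means is
CANONICAL: by linearity it is `σ + h(θ − bmean σ) + c(X + D_Wσ)` with `h` the HARMONIC extension (itself block-Landau as a pure gauge) and `c` the correction of the END's own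
field `Z = X + D_Wσ` — whose divergence is the END's datum `D`.  So the right letters are the sup rows of Bałaban's two scalar operators at curved `W` (the scalar companions of
(KL-B)'s vector rows; [B9] §3 ∕ [B4] TYPE), and NO smoothness letter: `‖λ‖ ≤ Ξ + C_H(6dMR + Ξ) + C_bD`.
WHAT ([folklore]; 0 def, 0 sorry).  **`transportLetter_blockLandau_of_rows`** (`d ≥ 1`, `L ≥ 2`, `curvSum ≤ 2L∕3`): (KL-T) of F167∕F169∕F171 for
`Gauge := (Y ↦ ∀ ν ∈ avgKernelGauges L N (j+1) W, Σ_{x∈periodBox} Σ_κ hsR (Y x κ) (gaugeDir W ν x κ) = 0)` with `C_R = C_H·6d·L^{j+1}`, `C_Ξ = 1 + C_H`, `C_D = C_b`.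
HONEST FRAMING (page 1): kinematics∕bookkeeping; (R-H) and the SIZE in (R-C) are DISPLAYED HYPOTHESES (scalar sup rows at scale `M`, NOT proved; (R-C)'s existence is F172;
power counting `C_H ≍ 1`, `C_b ≍ M²`); nothing of Bałaban's asserted; (APE) on curved data NOT proved; NOT ONE-STEP, NOT NE7; spine 0∕9; finite T⁴ rung (B)+1 — NOT infinite
volume, NOT mass gap, NOT `BetaPertH`, NOT Clay.  Continuum YM on T⁴ ⇐ BetaPertH ∧ nine spine estimates (0/9 proved); BetaPertH ⇐ (D1) ∧ (D4) ∧ CAP+tail; G-an2-4 gates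
asym, D1 and NE2/3/4.
-/

set_option autoImplicit false

open scoped BigOperators Matrix Matrix.Norms.L2Operator
open NormedSpace Finset

namespace Summit.QuantumFields.BalabanUV.T4Continuum.NE7BalabanGaugeTransportRows

open Literature.MathematicalPhysics.QuantumFieldTheory.Balaban1983to89
open B7Prop1Explicit B7Prop2Explicit UnitaryModel
open T4AveragingDeficitWall (Ad IsUnitaryCfg IsSkewDir SmallField curlAt dirL1)
open T4AveragingDeficitWallBoundary (IsPeriodicCfg periodBox)
open AveragingDeficitPeriodicCounting (IsPeriodicDir)
open AveragingDeficitMultiLevelPrep (cavgIter tower LevelSmall)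
open BlockAveragePushDirGauge (gaugeDir)
open NE3CovariantCalculus (hsR hsR_add_left)
open NE3TangentCovariantTower (dirIter QbarIter framePotW)
open NE3TangentCovariantStructure (gaugeDir_add_fun)
open NE3CovariantWeitzenbock (covDiv)
open NE3CovariantBlockMean (bmeanIterW bmeanIterW_skew_periodic)
open NE3FrameFreeSliceW (bmeanIterW_add)
open NE3CurvedFrameKill (framePotW_skew_periodic)
open NE3FramePotBoundW (tower_eq_pow_mul)
open NE3CovariantLineSumsTower (QbarIter_add)
open NE3ExactLineSumsTower (norm_bmeanIterW_le_of_sup)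
open NE3LinearisedAverageSup (curvSum norm_framePotW_le_sup)
open NE7BalabanGaugeTransport (QbarIter_gaugeDir_eq_bmean QbarIter_eq_neg_frame_of_tangent)
open NE3.PairLandauB8 (avgKernelGauges mem_avgKernelGauges_iff)

noncomputable section

variable {d : ℕ} {n : Type*} [Fintype n] [DecidableEq n]

/-- **(KL-T) FOR THE BLOCK-LANDAU GAUGE FROM THE TWO SCALAR ROWS (R-H) + (R-C).**  Data: `d ≥ 1`, `L ≥ 2`, `P = N·L^{j+1}`; `W` unitary `P`-periodic in the class with
`curvSum d L (j+1) x ≤ 2L∕3`.  DISPLAYED: (R-H) for every skew `N`-periodic coarse `θ′` with `‖θ′‖_∞ ≤ s` a skew `P`-periodic `h` with `bmeanIterW L (j+1) W h = θ′`,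
`Σ hsR (gaugeDir W h)(gaugeDir W ν) = 0` for all `ν ∈ N(Q′(W))`, and `‖h‖_∞ ≤ C_H·s`; (R-C) for every skew `P`-periodic `Z` with `‖covDiv_W Z‖_∞ ≤ D′` a `c ∈ N(Q′(W))` with
`Σ hsR (Z + gaugeDir W c)(gaugeDir W ν) = 0` for all `ν ∈ N(Q′(W))` and `‖c‖_∞ ≤ C_b·D′`.  THEN every skew periodic contour-tangent `X` with every skew periodic `σ` is moved by
`λ = σ + h + c` onto `ker QbarIter_W` and into the block-Landau gauge, `‖λ‖_∞ ≤ (C_H·6d·L^{j+1})·R + (1 + C_H)·Ξ + C_b·D`. [folklore] -/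
theorem transportLetter_blockLandau_of_rows [Nonempty n] (hd : 1 ≤ d) {L N : ℕ} [NeZero N] (hL : 2 ≤ L) (j : ℕ)
    {W : Site d → Fin d → (Matrix n n ℂ)ˣ} {x : ℝ} (hWu : IsUnitaryCfg W) (hWP : IsPeriodicCfg W ((N * L ^ (j + 1) : ℕ) : ℤ))
    (hx : 0 ≤ x) (hs : LevelSmall d L j x) (hWx : SmallField W x) (hA : curvSum d L (j + 1) x ≤ 2 / 3 * L)
    {CH Cb : ℝ}
    (hRH : ∀ θ' : Site d → Matrix n n ℂ, (∀ z, θ' z ∈ skewAdjoint (Matrix n n ℂ)) → (∀ (z : Site d) (i : Fin d), θ' (z + (N : ℤ) • e i) = θ' z) →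
      ∀ s : ℝ, (∀ z, ‖θ' z‖ ≤ s) →
      ∃ h : Site d → Matrix n n ℂ, (∀ y, h y ∈ skewAdjoint (Matrix n n ℂ)) ∧
        (∀ (y : Site d) (i : Fin d), h (y + ((N * L ^ (j + 1) : ℕ) : ℤ) • e i) = h y) ∧
        bmeanIterW L (j + 1) W h = θ' ∧
        (∀ nu ∈ avgKernelGauges (d := d) (n := n) L N (j + 1) W,
          ∑ y ∈ periodBox (d := d) (N * L ^ (j + 1)), ∑ κ : Fin d, hsR (gaugeDir W h y κ) (gaugeDir W nu y κ) = 0) ∧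
        (∀ y, ‖h y‖ ≤ CH * s))
    (hRC : ∀ Z : Site d → Fin d → Matrix n n ℂ, IsSkewDir Z → IsPeriodicDir Z ((N * L ^ (j + 1) : ℕ) : ℤ) →
      ∀ D' : ℝ, (∀ y, ‖covDiv W Z y‖ ≤ D') →
      ∃ c ∈ avgKernelGauges (d := d) (n := n) L N (j + 1) W,
        (∀ nu ∈ avgKernelGauges (d := d) (n := n) L N (j + 1) W,
          ∑ y ∈ periodBox (d := d) (N * L ^ (j + 1)), ∑ κ : Fin d, hsR (Z y κ + gaugeDir W c y κ) (gaugeDir W nu y κ) = 0) ∧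
        ∀ y, ‖c y‖ ≤ Cb * D') :
    ∀ X : Site d → Fin d → Matrix n n ℂ, IsSkewDir X → IsPeriodicDir X ((N * L ^ (j + 1) : ℕ) : ℤ) → dirIter L (j + 1) W X = 0 →
      ∀ σ : Site d → Matrix n n ℂ, (∀ y, σ y ∈ skewAdjoint (Matrix n n ℂ)) → (∀ (y : Site d) (i : Fin d), σ (y + ((N * L ^ (j + 1) : ℕ) : ℤ) • e i) = σ y) →
      ∀ R : ℝ, (∀ y κ', ‖X y κ'‖ ≤ R) → ∀ Ξ : ℝ, (∀ y, ‖σ y‖ ≤ Ξ) →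
      ∀ D : ℝ, (∀ y, ‖covDiv W (fun z κ => X z κ + gaugeDir W σ z κ) y‖ ≤ D) →
      ∃ lam : Site d → Matrix n n ℂ, (∀ y, lam y ∈ skewAdjoint (Matrix n n ℂ)) ∧
        (∀ (y : Site d) (i : Fin d), lam (y + ((N * L ^ (j + 1) : ℕ) : ℤ) • e i) = lam y) ∧
        QbarIter L (j + 1) W (fun y κ => X y κ + gaugeDir W lam y κ) = 0 ∧
        (∀ nu ∈ avgKernelGauges (d := d) (n := n) L N (j + 1) W,
          ∑ y ∈ periodBox (d := d) (N * L ^ (j + 1)), ∑ κ : Fin d, hsR ((fun y κ => X y κ + gaugeDir W lam y κ) y κ) (gaugeDir W nu y κ) = 0) ∧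
        ∀ y, ‖lam y‖ ≤ (CH * (6 * (d : ℝ) * (L : ℝ) ^ (j + 1))) * R + (1 + CH) * Ξ + Cb * D := by
  intro X hXs hXP hXT σ hσs hσP R hR Ξ hσΞ D hD
  have hL1 : 1 ≤ L := by omega
  have htow : (tower L N (j + 1) : ℕ) = N * L ^ (j + 1) := by rw [tower_eq_pow_mul, Nat.mul_comm]
  have hWP' : IsPeriodicCfg W ((tower L N (j + 1) : ℕ) : ℤ) := by rw [htow]; exact hWP
  have hXP' : IsPeriodicDir X ((tower L N (j + 1) : ℕ) : ℤ) := by rw [htow]; exact hXP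
  have hσP' : ∀ (y : Site d) (i : Fin d), σ (y + ((tower L N (j + 1) : ℕ) : ℤ) • e i) = σ y := by rw [htow]; exact hσP
  have hR0 : 0 ≤ R := (norm_nonneg _).trans (hR 0 ⟨0, by omega⟩)
  -- the accumulated frames `θ` of `X` and the block means `θσ` of `σ`
  obtain ⟨hθs, hθP⟩ := framePotW_skew_periodic hL1 j hWu hWP' hx hs hWx hXs hXP'
  obtain ⟨hθσs, hθσP⟩ := bmeanIterW_skew_periodic hL1 j hWu hWP' hx hs hWx hσs hσP'
  set θ : Site d → Matrix n n ℂ := framePotW L (j + 1) W X with hθdef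
  set θσ : Site d → Matrix n n ℂ := bmeanIterW L (j + 1) W σ with hθσdef
  have hθb : ∀ z, ‖θ z‖ ≤ 6 * (d : ℝ) * (L : ℝ) ^ (j + 1) * R := fun z => norm_framePotW_le_sup hL j hWu hx hs hWx hR0 hR hA z
  have hθσb : ∀ z, ‖θσ z‖ ≤ Ξ := fun z => norm_bmeanIterW_le_of_sup hL1 j hWu hx hs hWx hσΞ z
  -- (R-H) on `θ′ = θ − θσ`
  set s : ℝ := 6 * (d : ℝ) * (L : ℝ) ^ (j + 1) * R + Ξ with hsdef
  obtain ⟨h, hhs, hhP, hhm, hhL, hhb⟩ := hRH (fun z => θ z - θσ z)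
    (fun z => (skewAdjoint (Matrix n n ℂ)).sub_mem (hθs z) (hθσs z)) (fun z i => by simp only [hθP z i, hθσP z i]) s
    (fun z => (norm_sub_le _ _).trans (by rw [hsdef]; exact add_le_add (hθb z) (hθσb z)))
  have hhP' : ∀ (y : Site d) (i : Fin d), h (y + ((tower L N (j + 1) : ℕ) : ℤ) • e i) = h y := by rw [htow]; exact hhP
  -- (R-C) on the END's own field `Z = X + gaugeDir W σ`
  set Z : Site d → Fin d → Matrix n n ℂ := fun y κ => X y κ + gaugeDir W σ y κ with hZdef
  have hZs : IsSkewDir Z := NE7SliceLetterBalabanGauge.isSkewDir_add hXs (NE7ExactCurrent.isSkewDir_gaugeDir hWu hσs)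
  have hZP : IsPeriodicDir Z ((N * L ^ (j + 1) : ℕ) : ℤ) :=
    NE7SliceLetterBalabanGauge.isPeriodicDir_add' hXP (BlockAveragePushDirGauge.isPeriodicDir_gaugeDir hWP hσP)
  obtain ⟨c, hc, hcL, hcb⟩ := hRC Z hZs hZP D hD
  obtain ⟨hcs, hcP, hcm⟩ := mem_avgKernelGauges_iff.mp hc
  have hcP' : ∀ (y : Site d) (i : Fin d), c (y + ((tower L N (j + 1) : ℕ) : ℤ) • e i) = c y := by rw [htow]; exact hcP
  -- the total gauge parameter `λ = σ + h + c`
  set lam : Site d → Matrix n n ℂ := fun y => σ y + h y + c y with hlamdef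
  have hlams : ∀ y, lam y ∈ skewAdjoint (Matrix n n ℂ) := fun y =>
    (skewAdjoint (Matrix n n ℂ)).add_mem ((skewAdjoint (Matrix n n ℂ)).add_mem (hσs y) (hhs y)) (hcs y)
  have hlamP : ∀ (y : Site d) (i : Fin d), lam (y + ((N * L ^ (j + 1) : ℕ) : ℤ) • e i) = lam y := fun y i => by
    simp only [hlamdef, hσP y i, hhP y i, hcP y i]
  have hlamP' : ∀ (y : Site d) (i : Fin d), lam (y + ((tower L N (j + 1) : ℕ) : ℤ) • e i) = lam y := by rw [htow]; exact hlamP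
  have hblam : bmeanIterW L (j + 1) W lam = θ := by
    have h1 : lam = (σ + h) + c := by funext y; simp [hlamdef]
    rw [h1, bmeanIterW_add, bmeanIterW_add, hhm, hcm]
    funext z
    simp only [Pi.add_apply, Pi.zero_apply, hθσdef]
    abel
  -- pointwise splitting of the moved field: `X + D_Wλ = (Z + D_W c) + D_W h`
  have hsplit : ∀ (y : Site d) (κ : Fin d), X y κ + gaugeDir W lam y κ = (Z y κ + gaugeDir W c y κ) + gaugeDir W h y κ := by
    intro y κ
    have h1 : gaugeDir W lam y κ = gaugeDir W σ y κ + gaugeDir W h y κ + gaugeDir W c y κ := by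
      rw [hlamdef, gaugeDir_add_fun, gaugeDir_add_fun]
    rw [h1]
    simp only [hZdef]
    abel
  refine ⟨lam, hlams, hlamP, ?_, ?_, ?_⟩
  · -- straight-tangency: the block means of `λ` are exactly the accumulated frames of `X`
    rw [QbarIter_add hL1 j hWu hx hs hWx X (gaugeDir W lam), QbarIter_eq_neg_frame_of_tangent hL1 j hWu hWP' hx hs hWx hXs hXP' hXT,
      QbarIter_gaugeDir_eq_bmean hL1 j hWu hWP' hx hs hWx hlams hlamP', hblam]
    funext z κ
    simp only [Pi.zero_apply]
    exact neg_add_cancel _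
  · -- the block-Landau condition: (R-C)'s for `Z + D_W c` plus (R-H)'s for `D_W h`
    intro nu hnu
    have h1 := hcL nu hnu
    have h2 := hhL nu hnu
    calc ∑ y ∈ periodBox (d := d) (N * L ^ (j + 1)), ∑ κ : Fin d, hsR (X y κ + gaugeDir W lam y κ) (gaugeDir W nu y κ)
        = ∑ y ∈ periodBox (d := d) (N * L ^ (j + 1)), ∑ κ : Fin d,
            (hsR (Z y κ + gaugeDir W c y κ) (gaugeDir W nu y κ) + hsR (gaugeDir W h y κ) (gaugeDir W nu y κ)) := by
          refine Finset.sum_congr rfl fun y _ => Finset.sum_congr rfl fun κ _ => ?_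
          rw [hsplit, hsR_add_left]
      _ = 0 := by rw [Finset.sum_comm]; simp only [Finset.sum_add_distrib]; rw [Finset.sum_comm, h1, Finset.sum_comm, h2, add_zero]
  · -- the size
    intro y
    calc ‖lam y‖ = ‖σ y + h y + c y‖ := rfl
      _ ≤ ‖σ y‖ + ‖h y‖ + ‖c y‖ := (norm_add_le _ _).trans (by gcongr; exact norm_add_le _ _)
      _ ≤ Ξ + CH * s + Cb * D := add_le_add (add_le_add (hσΞ y) (hhb y)) (hcb y)
      _ = (CH * (6 * (d : ℝ) * (L : ℝ) ^ (j + 1))) * R + (1 + CH) * Ξ + Cb * D := by rw [hsdef]; ring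

end

end Summit.QuantumFields.BalabanUV.T4Continuum.NE7BalabanGaugeTransportRows
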